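import Summits.BirchSwinnertonDyer.BirchSwinnertonDyer.Theorems.Rank2Observatory2DescClGlue
import Literature.NumberTheory.NumberFields.CubicFieldIntegers
import Mathlib.LinearAlgebra.Matrix.Nondegenerate
import HarnessLib

/-!
# BirchSwinnertonDyer — rank ≥ 2 observatory: KERNEL-2DESC-CL, the LOCAL INDEX CERTIFICATE (`𝓞 K = ℤ[θ]` without a squarefree discriminant)

HONEST FRAMING: per-curve certified theorems and census instruments; no claim on BSD in rank ≥ 2.

Generic layer of the KERNEL-2DESC-CL instrument (design `b2b-bsdr2-cert-1/KERNEL-2DESC-CL.md`, cut 1b / cut 2b).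
The per-field files prove `RingOfIntegers.exponent θ = 1` (i.e. `𝓞 K = ℤ[θ]`, the input of Dedekind–Kummer)
through `MonicCubic.exponent_thetaInt`, whose arithmetic input is the square-factor condition on `Δ(g)` — in
practice: `Δ(g)` squarefree.  For a monogenic cubic field whose discriminant is NOT squarefree (`4 ∣ Δ_K`, …) this
file supplies the replacement: a prime-by-prime certificate.

* `exists_of_dvd_indexDet` (any degree): if a prime `p` divides the index determinant
  `indexDet B = det(θ^j in an integral basis)` (`Literature…IntegralBasisCriterion`), then the matrix is singular
  mod `p`, a kernel vector `v̄ ≠ 0` lifts to `0 ≤ v_j < p` not all zero, and `(∑ v_j θ^j)/p` is an algebraic integer.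
* `isUnit_indexDet_of_local`: hence `indexDet = ±1` as soon as, for every prime `p` with `p² ∣ disc(1, θ, …)`
  (`indexDet² · d_K = disc`), no such `(∑ v_j θ^j)/p` is integral.
* Cubic packaging `exponent_thetaInt_of_local` (`K = ℚ(θ)`, `θ³ + aθ² + bθ + c = 0`): `𝓞 K = ℤ[θ]` from the local
  certificates, and the three REFUTATION LEMMAS by which a per-field file discharges a candidate
  `W = x + yθ + zθ²`, `0 ≤ x, y, z < p`: `p ∤ Tr W` (`ne_of_trace`), `p³ ∤ N(W)` (`ne_of_norm`), `p³ ∤ N(W + p)`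
  (`ne_of_norm_shift`) — integer forms `traceZ`, `normFormZ` (= `MonicCubic.trace_lin / norm_lin`).  The battery is
  complete: with `w = W/p`, `N(w + 1) = 1 + s₁(W)/p + s₂(W)/p² + s₃(W)/p³`, so given `p ∣ s₁(W)` and `p³ ∣ s₃(W)` the
  third test reads `p² ∣ s₂(W)`, and `w` is integral iff its characteristic polynomial is.

Sorry-free; axioms `propext`, `Classical.choice`, `Quot.sound`.
[cite: Marcus2018, Ch. 2, Thm. 13 and Exercise 27] [cite: Cohen1993, §6.1 (orders and the index), §4.8.2]
-/

noncomputable section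

set_option linter.dupNamespace false

open scoped NumberField
open Module NumberField Polynomial

namespace Summit.BirchSwinnertonDyer.BirchSwinnertonDyer.Rank2Observatory.TwoDescCl

open Literature.NumberTheory.NumberFields

variable {K : Type*} [Field K] [NumberField K]

/-! ## Any degree: a prime dividing the index determinant produces an integral `(∑ vⱼ θʲ)/p` -/

/-- If a prime `p` divides `indexDet B`, then some `(∑ⱼ vⱼ θʲ)/p` with `0 ≤ vⱼ < p` not all zero is an
algebraic integer (the matrix of `1, θ, …, θⁿ⁻¹` in an integral basis is singular mod `p`).
[cite: Marcus2018, Ch. 2, Thm. 13 and Exercise 27] -/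
theorem exists_of_dvd_indexDet (B : PowerBasis ℚ K) (hint : IsIntegral ℤ B.gen) {n : ℕ} (hn : B.dim = n)
    (p : ℕ) [hp : Fact p.Prime] (hdvd : (p : ℤ) ∣ indexDet B hint) :
    ∃ v : Fin n → ℕ, (∀ j, v j < p) ∧ (∃ j, v j ≠ 0) ∧
      ∃ w : 𝓞 K, (p : K) * w = ∑ j, (v j : K) * B.gen ^ (j : ℕ) := by
  classical
  subst hn
  set M : Matrix (Fin B.dim) (Fin B.dim) ℤ := (intBasis B).toMatrix (powInt B hint) with hM
  have hdet : M.det = indexDet B hint := by rw [indexDet, Basis.det_apply]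
  set Mp : Matrix (Fin B.dim) (Fin B.dim) (ZMod p) := M.map (Int.castRingHom (ZMod p)) with hMp
  have hdet0 : Mp.det = 0 := by
    have h1 : (Int.castRingHom (ZMod p)) M.det = Mp.det := by
      rw [RingHom.map_det, RingHom.mapMatrix_apply]
    rw [← h1, hdet, eq_intCast]
    exact (ZMod.intCast_zmod_eq_zero_iff_dvd _ p).mpr hdvd
  obtain ⟨u, hu0, hu⟩ := Matrix.exists_mulVec_eq_zero_iff.mpr hdet0
  refine ⟨fun j => (u j).val, fun j => (u j).val_lt, ?_, ?_⟩
  · by_contra h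
    refine hu0 (funext fun j => (ZMod.val_eq_zero (u j)).mp ?_)
    by_contra hj
    exact h ⟨j, hj⟩
  · -- the integer coordinates `∑ⱼ M i j vⱼ` are divisible by `p`
    have hc : ∀ i, (p : ℤ) ∣ ∑ j, M i j * ((u j).val : ℤ) := by
      intro i
      have hi := congr_fun hu i
      rw [Pi.zero_apply, Matrix.mulVec, dotProduct] at hi
      refine (ZMod.intCast_zmod_eq_zero_iff_dvd _ p).mp ?_
      push_cast
      have : ∀ j, (Mp i j) * u j = ((M i j : ℤ) : ZMod p) * (((u j).val : ℕ) : ZMod p) := by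
        intro j
        rw [ZMod.natCast_zmod_val, hMp, Matrix.map_apply, Int.coe_castRingHom]
      simpa [this] using hi
    choose c hc using hc
    refine ⟨∑ i, c i • intBasis B i, ?_⟩
    have hpow : ∀ j, powInt B hint j = ∑ i, M i j • intBasis B i := by
      intro j
      conv_lhs => rw [← (intBasis B).sum_repr (powInt B hint j)]
      simp only [hM, Basis.toMatrix_apply]
    -- the identity in `𝓞 K`
    have key : ((p : ℤ) • ∑ i, c i • intBasis B i : 𝓞 K) = ∑ j, ((u j).val : ℤ) • powInt B hint j := by
      calc ((p : ℤ) • ∑ i, c i • intBasis B i : 𝓞 K)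
          = ∑ i, (∑ j, M i j * ((u j).val : ℤ)) • intBasis B i := by
            rw [Finset.smul_sum]
            refine Finset.sum_congr rfl fun i _ => ?_
            rw [smul_smul, hc i]
        _ = ∑ i, ∑ j, (((u j).val : ℤ) * M i j) • intBasis B i := by
            refine Finset.sum_congr rfl fun i _ => ?_
            rw [Finset.sum_smul]
            refine Finset.sum_congr rfl fun j _ => ?_
            rw [mul_comm]
        _ = ∑ j, ∑ i, (((u j).val : ℤ) * M i j) • intBasis B i := Finset.sum_comm
        _ = ∑ j, ((u j).val : ℤ) • powInt B hint j := by
            refine Finset.sum_congr rfl fun j _ => ?_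
            rw [hpow j, Finset.smul_sum]
            refine Finset.sum_congr rfl fun i _ => ?_
            rw [smul_smul]
    -- push the identity to `K`
    have key' := congrArg (fun x : 𝓞 K => (x : K)) key
    simpa [-ZMod.natCast_val, zsmul_eq_mul, map_sum, coe_powInt, PowerBasis.coe_basis] using key'

/-- **Local criterion for a power integral basis.** If, for every prime `p` whose square divides
`disc(1, θ, …, θⁿ⁻¹)`, no `(∑ⱼ vⱼ θʲ)/p` (`0 ≤ vⱼ < p`, not all zero) is an algebraic integer, then
`indexDet = ±1` (so `𝓞 K = ℤ[θ]` by `mem_adjoin_of_isUnit_indexDet`). [cite: Marcus2018, Ch. 2, Thm. 13 and Exercise 27] -/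
theorem isUnit_indexDet_of_local (B : PowerBasis ℚ K) (hint : IsIntegral ℤ B.gen) {n : ℕ} (hn : B.dim = n)
    (d : ℤ) (hd : Algebra.discr ℚ ⇑B.basis = d)
    (h : ∀ p : ℕ, p.Prime → (p : ℤ) ^ 2 ∣ d → ∀ v : Fin n → ℕ, (∀ j, v j < p) → (∃ j, v j ≠ 0) →
      ∀ w : 𝓞 K, (p : K) * w ≠ ∑ j, (v j : K) * B.gen ^ (j : ℕ)) :
    IsUnit (indexDet B hint) := by
  by_contra hnu
  have h1 : (indexDet B hint).natAbs ≠ 1 := fun h1 => hnu (Int.isUnit_iff_natAbs_eq.mpr h1)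
  obtain ⟨q, hq, hqd⟩ := Int.exists_prime_and_dvd h1
  set p : ℕ := q.natAbs with hp
  have hpp : p.Prime := Int.prime_iff_natAbs_prime.mp hq
  have hpd : (p : ℤ) ∣ indexDet B hint := Int.natAbs_dvd.mpr hqd
  have hdZ : d = indexDet B hint ^ 2 * NumberField.discr K := by
    have := discr_powerBasis_eq_indexDet_sq_mul_discr B hint
    rw [hd] at this
    exact_mod_cast this
  have hp2 : (p : ℤ) ^ 2 ∣ d := by
    rw [hdZ]
    exact Dvd.dvd.mul_right (pow_dvd_pow_of_dvd hpd 2) _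
  haveI := Fact.mk hpp
  obtain ⟨v, hv, hv0, w, hw⟩ := exists_of_dvd_indexDet B hint hn p hpd
  exact h p hpp hp2 v hv hv0 w hw

/-! ## Cubic fields: `𝓞 K = ℤ[θ]` from the local certificates, and the refutation lemmas -/

section Cubic

variable {a b c : ℤ} {θ : K}

/-- The trace form `Tr(x + yθ + zθ²) = 3x − ay + (a² − 2b)z` over `ℤ`. [cite: Marcus2018, Ch. 2, Thm. 4] -/
def traceZ (a b x y z : ℤ) : ℤ := 3 * x - a * y + (a ^ 2 - 2 * b) * z

/-- The norm form `N(x + yθ + zθ²)` over `ℤ` (`= MonicCubic.normForm` on integers). [cite: Marcus2018, Ch. 2, Thm. 4] -/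
def normFormZ (a b c x y z : ℤ) : ℤ :=
  x ^ 3 - a * x ^ 2 * y + (a ^ 2 - 2 * b) * x ^ 2 * z + b * x * y ^ 2 +
    (3 * c - a * b) * x * y * z + (b ^ 2 - 2 * a * c) * x * z ^ 2 - c * y ^ 3 +
    a * c * y ^ 2 * z - b * c * y * z ^ 2 + c ^ 2 * z ^ 3

/-- `MonicCubic.normForm` on integer arguments is the integer form `normFormZ`. [folklore] -/
theorem normForm_intCast (a b c x y z : ℤ) :
    MonicCubic.normForm a b c x y z = (normFormZ a b c x y z : ℚ) := by
  simp only [MonicCubic.normForm, normFormZ]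
  push_cast
  ring

/-- `MonicCubic.normForm` on natural-number arguments is the integer form `normFormZ`. [folklore] -/
theorem normForm_natCast (a b c : ℤ) (x y z : ℕ) :
    MonicCubic.normForm a b c x y z = (normFormZ a b c x y z : ℚ) := by
  simp only [MonicCubic.normForm, normFormZ]
  push_cast
  ring

/-- If `p · w = x + yθ + zθ²` with `w ∈ 𝓞 K` then `p ∣ Tr(x + yθ + zθ²)`; contrapositive. [cite: Marcus2018, Ch. 2, Thm. 4] -/
theorem ne_of_trace (hirr : Irreducible (MonicCubic.polyQ a b c)) (hθ : aeval θ (MonicCubic.poly a b c) = 0)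
    (h3 : finrank ℚ K = 3) (p : ℕ) (x y z : ℕ) (hT : ¬ (p : ℤ) ∣ traceZ a b x y z) (w : 𝓞 K) :
    (p : K) * w ≠ (x : K) + (y : K) * θ + (z : K) * θ ^ 2 := by
  intro hw
  obtain ⟨m, hm⟩ : ∃ m : ℤ, (m : ℚ) = Algebra.trace ℚ K (w : K) :=
    IsIntegrallyClosed.isIntegral_iff.mp (Algebra.isIntegral_trace (RingOfIntegers.isIntegral_coe w))
  have hsm : (p : K) * w = (p : ℚ) • (w : K) := by
    rw [Algebra.smul_def, map_natCast]
  have htr : Algebra.trace ℚ K ((p : K) * w) = p * m := by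
    rw [hsm, map_smul, smul_eq_mul, hm]
  have hx : ((x : ℚ) : K) = (x : K) := by norm_cast
  have hy : ((y : ℚ) : K) = (y : K) := by norm_cast
  have hz : ((z : ℚ) : K) = (z : K) := by norm_cast
  have htr' := MonicCubic.trace_lin hirr hθ h3 (x : ℚ) (y : ℚ) (z : ℚ)
  rw [hx, hy, hz, ← hw, htr] at htr'
  apply hT
  refine ⟨m, ?_⟩
  have : ((traceZ a b x y z : ℤ) : ℚ) = (p : ℚ) * m := by
    rw [traceZ]; push_cast; linarith
  exact_mod_cast this

/-- If `p · w = x + yθ + zθ²` with `w ∈ 𝓞 K` then `p³ ∣ N(x + yθ + zθ²)`; contrapositive. [cite: Marcus2018, Ch. 2, Thm. 4] -/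
theorem ne_of_norm (hirr : Irreducible (MonicCubic.polyQ a b c)) (hθ : aeval θ (MonicCubic.poly a b c) = 0)
    (h3 : finrank ℚ K = 3) (p : ℕ) (x y z : ℕ) (hN : ¬ (p : ℤ) ^ 3 ∣ normFormZ a b c x y z) (w : 𝓞 K) :
    (p : K) * w ≠ (x : K) + (y : K) * θ + (z : K) * θ ^ 2 := by
  intro hw
  obtain ⟨m, hm⟩ : ∃ m : ℤ, (m : ℚ) = Algebra.norm ℚ (w : K) :=
    IsIntegrallyClosed.isIntegral_iff.mp (Algebra.isIntegral_norm ℚ (RingOfIntegers.isIntegral_coe w))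
  have hp : (p : K) = algebraMap ℚ K (p : ℚ) := by rw [map_natCast]
  have hno : Algebra.norm ℚ ((p : K) * w) = (p : ℚ) ^ 3 * m := by
    rw [map_mul, hp, Algebra.norm_algebraMap, h3, hm]
  have hx : ((x : ℚ) : K) = (x : K) := by norm_cast
  have hy : ((y : ℚ) : K) = (y : K) := by norm_cast
  have hz : ((z : ℚ) : K) = (z : K) := by norm_cast
  have hno' := MonicCubic.norm_lin hirr hθ h3 (x : ℚ) (y : ℚ) (z : ℚ)
  rw [hx, hy, hz, ← hw, hno, normForm_natCast] at hno'
  apply hN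
  refine ⟨m, ?_⟩
  exact_mod_cast hno'.symm

/-- The shifted norm test: if `p · w = x + yθ + zθ²` then `p · (w + 1) = (x + p) + yθ + zθ²`, so
`p³ ∣ N((x + p) + yθ + zθ²)`; contrapositive (this is the test of the middle coefficient `s₂`). [cite: Marcus2018, Ch. 2, Thm. 4] -/
theorem ne_of_norm_shift (hirr : Irreducible (MonicCubic.polyQ a b c)) (hθ : aeval θ (MonicCubic.poly a b c) = 0)
    (h3 : finrank ℚ K = 3) (p : ℕ) (x y z : ℕ) (hN : ¬ (p : ℤ) ^ 3 ∣ normFormZ a b c ((x + p : ℕ) : ℤ) y z) (w : 𝓞 K) :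
    (p : K) * w ≠ (x : K) + (y : K) * θ + (z : K) * θ ^ 2 := by
  intro hw
  refine ne_of_norm hirr hθ h3 p (x + p) y z hN (w + 1) ?_
  push_cast
  rw [mul_add, mul_one, hw]
  ring

/-- **`𝓞 K = ℤ[θ]` (conductor exponent `1`) from the LOCAL index certificates**: for every prime `p` with
`p² ∣ Δ(g)` and every `(x, y, z) ∈ [0, p)³ ∖ 0`, `(x + yθ + zθ²)/p ∉ 𝓞 K`. [cite: Marcus2018, Ch. 2, Thm. 13 and Exercise 27; Ch. 3, Thm. 27] -/
theorem exponent_thetaInt_of_local (hirr : Irreducible (MonicCubic.polyQ a b c))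
    (hθ : aeval θ (MonicCubic.poly a b c) = 0) (h3 : finrank ℚ K = 3)
    (h : ∀ p : ℕ, p.Prime → (p : ℤ) ^ 2 ∣ MonicCubic.disc a b c → ∀ x y z : ℕ, x < p → y < p → z < p →
      (x ≠ 0 ∨ y ≠ 0 ∨ z ≠ 0) → ∀ w : 𝓞 K, (p : K) * w ≠ (x : K) + (y : K) * θ + (z : K) * θ ^ 2) :
    RingOfIntegers.exponent (MonicCubic.thetaInt hθ) = 1 := by
  have hu : IsUnit (indexDet (MonicCubic.pb hirr hθ h3) (MonicCubic.isIntegral_pb_gen hirr hθ h3)) := by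
    refine isUnit_indexDet_of_local _ _ (MonicCubic.pb_dim hirr hθ h3) (MonicCubic.disc a b c)
      (MonicCubic.discr_pb hirr hθ h3) ?_
    intro p hp hp2 v hv hv0 w hw
    rw [Fin.sum_univ_three, MonicCubic.pb_gen] at hw
    simp only [Fin.val_zero, pow_zero, mul_one, Fin.val_one, pow_one, Fin.val_two] at hw
    obtain ⟨j, hj⟩ := hv0
    refine h p hp hp2 (v 0) (v 1) (v 2) (hv 0) (hv 1) (hv 2) ?_ w hw
    fin_cases j
    · exact Or.inl hj
    · exact Or.inr (Or.inl hj)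
    · exact Or.inr (Or.inr hj)
  refine RingOfIntegers.exponent_eq_one_iff.mpr (Algebra.eq_top_iff.mpr fun x => ?_)
  have hx := mem_adjoin_of_isUnit_indexDet _ _ hu x
  rw [MonicCubic.pb_gen] at hx
  rw [Algebra.adjoin_singleton_eq_range_aeval] at hx ⊢
  obtain ⟨g, hg⟩ := hx
  refine ⟨g, ?_⟩
  apply IsFractionRing.injective (𝓞 K) K
  change algebraMap (𝓞 K) K (aeval (MonicCubic.thetaInt hθ) g) = (x : K)
  rw [← aeval_algebraMap_apply]
  exact hg

/-! ### The decidable local certificate and the factorisation wrapper used by the per-field files -/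

/-- The local certificate at `p` as a Boolean: every `(x, y, z) ∈ [0, p)³ ∖ 0` fails one of the three tests
(`p ∤ Tr W`, `p³ ∤ N(W)`, `p³ ∤ N(W + p)`, `W = x + yθ + zθ²`). [cite: Marcus2018, Ch. 2, Thm. 13 and Exercise 27] -/
def localCertOK (a b c : ℤ) (p : ℕ) : Bool :=
  (List.range p).all fun x => (List.range p).all fun y => (List.range p).all fun z =>
    (x == 0 && y == 0 && z == 0) || !decide ((p : ℤ) ∣ traceZ a b x y z) ||
      !decide ((p : ℤ) ^ 3 ∣ normFormZ a b c x y z) || !decide ((p : ℤ) ^ 3 ∣ normFormZ a b c ((x + p : ℕ) : ℤ) y z)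

/-- Soundness of the Boolean certificate: no `(x + yθ + zθ²)/p` with `(x, y, z) ∈ [0, p)³ ∖ 0` is an algebraic
integer. [cite: Marcus2018, Ch. 2, Thm. 13 and Exercise 27] -/
theorem localCert_sound (hirr : Irreducible (MonicCubic.polyQ a b c)) (hθ : aeval θ (MonicCubic.poly a b c) = 0)
    (h3 : finrank ℚ K = 3) (p : ℕ) (hc : localCertOK a b c p = true) (x y z : ℕ) (hx : x < p) (hy : y < p)
    (hz : z < p) (hne : x ≠ 0 ∨ y ≠ 0 ∨ z ≠ 0) (w : 𝓞 K) :
    (p : K) * w ≠ (x : K) + (y : K) * θ + (z : K) * θ ^ 2 := by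
  have h1 := List.all_eq_true.mp hc x (List.mem_range.mpr hx)
  have h2 := List.all_eq_true.mp h1 y (List.mem_range.mpr hy)
  have h3' := List.all_eq_true.mp h2 z (List.mem_range.mpr hz)
  simp only [Bool.or_eq_true, Bool.and_eq_true, beq_iff_eq, Bool.not_eq_true', decide_eq_false_iff_not] at h3'
  rcases h3' with ((⟨⟨rfl, rfl⟩, rfl⟩ | hT) | hN) | hS
  · simp at hne
  · exact ne_of_trace hirr hθ h3 p x y z hT w
  · exact ne_of_norm hirr hθ h3 p x y z hN w
  · exact ne_of_norm_shift hirr hθ h3 p x y z hS w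

/-- **`𝓞 K = ℤ[θ]` from a factorisation `|Δ(g)| = ∏ Pᵢ^{eᵢ}` and, for each `Pᵢ`, either `Pᵢ² ∤ Δ(g)` or the Boolean
local certificate at `Pᵢ`.**  This is the form the per-field KERNEL-2DESC-CL files use when `Δ(g)` is not
squarefree. [cite: Marcus2018, Ch. 2, Thm. 13 and Exercise 27; Ch. 3, Thm. 27] -/
theorem exponent_thetaInt_of_localCerts (hirr : Irreducible (MonicCubic.polyQ a b c))
    (hθ : aeval θ (MonicCubic.poly a b c) = 0) (h3 : finrank ℚ K = 3) {k : ℕ} (P e : Fin k → ℕ)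
    (hP : ∀ i, (P i).Prime) (hD : (MonicCubic.disc a b c).natAbs = ∏ i, P i ^ e i)
    (hcert : ∀ i, ¬ ((P i : ℤ) ^ 2 ∣ MonicCubic.disc a b c) ∨ localCertOK a b c (P i) = true) :
    RingOfIntegers.exponent (MonicCubic.thetaInt hθ) = 1 := by
  refine exponent_thetaInt_of_local hirr hθ h3 fun p hp hp2 x y z hx hy hz hne w => ?_
  have hpd : p ∣ (MonicCubic.disc a b c).natAbs :=
    Int.natCast_dvd.mp (dvd_trans (dvd_pow_self (p : ℤ) two_ne_zero) hp2)
  rw [hD] at hpd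
  obtain ⟨i, hi⟩ := exists_eq_of_prime_dvd_prod_pow P e hP hp hpd
  subst hi
  rcases hcert i with hnd | hc
  · exact absurd hp2 hnd
  · exact localCert_sound hirr hθ h3 (P i) hc x y z hx hy hz hne w

end Cubic

end Summit.BirchSwinnertonDyer.BirchSwinnertonDyer.Rank2Observatory.TwoDescCl
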